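import Mathlib.Analysis.Calculus.ParametricIntegral
import Literature.Analysis.FunctionSpaces.LiebWuIntegralsProofs
import HarnessLib

/-!
# The `U`-derivative of the Lieb–Wu energy: the double occupancy of the half-filled Hubbard chain

Topic `Analysis/FunctionSpaces` (companion of `LiebWuIntegrals`, `LiebWuIntegralsProofs`). The
Lieb–Wu ground-state energy per site of the half-filled Hubbard chain (`t = 1`),
`e(U) = -4 ∫₀^∞ J₀(ω) J₁(ω) / (ω (1 + e^{ωU/2})) dω` (`liebWuEnergy`; Lieb–Wu, PRL 20 (1968) 1445,
eq. (20)), is differentiable in `U` on `(0, ∞)` and may be differentiated under the integral sign: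

  `e'(U) = 2 ∫₀^∞ J₀(ω) J₁(ω) e^{ωU/2} / (1 + e^{ωU/2})² dω =: d(U)`

(`liebWuDoubleOccupancy`, `hasDerivAt_liebWuEnergy`, `deriv_liebWuEnergy`). By the
Hellmann–Feynman / concavity argument `∂E₀/∂U = ⟨Σ_x n_{x↑} n_{x↓}⟩`, `d(U)` is the ground-state
double occupancy per site of the half-filled chain — the exact (Bethe-ansatz) comparison value for
certified double-occupancy intervals (bundle `pub-mbboot`; the identification with torus-limit
ground states of the chain is made in `MathematicalPhysics/QuantumLattice`). The analysis is
elementary: the `U`-derivative of the integrand is `-J₀ J₁ e^{ωU/2} / (2 (1 + e^{ωU/2})²)`, bounded by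
`e^{-ωU'/2}/4 ≤ e^{-ωU/4}/4` for `U' > U/2` (`|J₀ J₁| ≤ (J₀² + J₁²)/2 ≤ 1/2`, DLMF 10.14.1 in the
form `sq_besselJ_zero_add_sq_besselJ_one_le_one`, and `e^{a}/(1 + e^{a})² ≤ e^{-a}`), so the
dominated-convergence derivative lemma `hasDerivAt_integral_of_dominated_loc_of_deriv_le` applies.
Everything is PROVED; no named fact.

## References
* E. H. Lieb, F. Y. Wu, *Absence of Mott transition in an exact solution of the short-range,
  one-band model in one dimension*, Phys. Rev. Lett. 20 (1968) 1445, eq. (20).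
  [cite: LiebWuPRL1968, eq. (20)]
* E. H. Lieb, F. Y. Wu, *The one-dimensional Hubbard model: a reminiscence*, Physica A 321 (2003)
  1, §6. [cite: LiebWuPhysicaA2003, §6]
-/

noncomputable section

open scoped Topology
open Filter Set MeasureTheory

namespace Literature.Analysis.FunctionSpaces

section Hubbard

/-- The integrand of the `U`-derivative (up to sign): `J₀(ω) J₁(ω) e^{ωU/2} / (2 (1 + e^{ωU/2})²)`;
`∂_U [J₀ J₁ / (ω (1 + e^{ωU/2}))] = -liebWuDoccIntegrand U ω` (`hasDerivAt_liebWuEnergyIntegrand`).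
[cite: LiebWuPRL1968, eq. (20)] -/
def liebWuDoccIntegrand (U ω : ℝ) : ℝ :=
  besselJ 0 ω * besselJ 1 ω * Real.exp (ω * U / 2) / (2 * (1 + Real.exp (ω * U / 2)) ^ 2)

/-- **The Lieb–Wu double occupancy** of the half-filled Hubbard chain (`t = 1`):
`d(U) = e'(U) = 2 ∫₀^∞ J₀(ω) J₁(ω) e^{ωU/2} / (1 + e^{ωU/2})² dω = 4 ∫₀^∞ liebWuDoccIntegrand U`
(the `U`-derivative of Lieb–Wu's eq. (20): `hasDerivAt_liebWuEnergy`). [cite: LiebWuPRL1968, eq. (20)] -/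
def liebWuDoubleOccupancy (U : ℝ) : ℝ :=
  4 * ∫ ω in Ioi (0 : ℝ), liebWuDoccIntegrand U ω

/-- `liebWuDoubleOccupancy` unfolded. [cite: LiebWuPRL1968, eq. (20)] -/
theorem liebWuDoubleOccupancy_eq (U : ℝ) :
    liebWuDoubleOccupancy U = 4 * ∫ ω in Ioi (0 : ℝ),
      besselJ 0 ω * besselJ 1 ω * Real.exp (ω * U / 2) / (2 * (1 + Real.exp (ω * U / 2)) ^ 2) :=
  rfl

/-- **Pointwise `U`-derivative of the Lieb–Wu integrand** (`ω ≠ 0`):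
`∂_U [J₀ J₁ / (ω (1 + e^{ωU/2}))] = -J₀ J₁ e^{ωU/2} / (2 (1 + e^{ωU/2})²)`. [cite: LiebWuPRL1968, eq. (20)] -/
theorem hasDerivAt_liebWuEnergyIntegrand {ω : ℝ} (hω : ω ≠ 0) (U : ℝ) :
    HasDerivAt (fun x => liebWuEnergyIntegrand x ω) (-liebWuDoccIntegrand U ω) U := by
  have hexp : HasDerivAt (fun x : ℝ => Real.exp (ω * x / 2)) (Real.exp (ω * U / 2) * (ω / 2)) U := by
    have h1 : HasDerivAt (fun x : ℝ => ω * x / 2) (ω / 2) U := by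
      simpa using ((hasDerivAt_id U).const_mul ω).div_const 2
    exact h1.exp
  have hden : HasDerivAt (fun x : ℝ => ω * (1 + Real.exp (ω * x / 2)))
      (ω * (Real.exp (ω * U / 2) * (ω / 2))) U := (hexp.const_add 1).const_mul ω
  have hne : ω * (1 + Real.exp (ω * U / 2)) ≠ 0 := mul_ne_zero hω (by positivity)
  have h : HasDerivAt (fun x => liebWuEnergyIntegrand x ω)
      ((0 * (ω * (1 + Real.exp (ω * U / 2))) -
          besselJ 0 ω * besselJ 1 ω * (ω * (Real.exp (ω * U / 2) * (ω / 2)))) /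
        (ω * (1 + Real.exp (ω * U / 2))) ^ 2) U :=
    (hasDerivAt_const U (besselJ 0 ω * besselJ 1 ω)).div hden hne
  refine h.congr_deriv ?_
  rw [liebWuDoccIntegrand]
  field_simp
  ring

/-- `e^{a} / (1 + e^{a})² ≤ e^{-a}`. [folklore] -/
private theorem exp_div_one_add_exp_sq_le (a : ℝ) :
    Real.exp a / (1 + Real.exp a) ^ 2 ≤ Real.exp (-a) := by
  have hea : 0 < Real.exp a := Real.exp_pos a
  have hpos : 0 < (1 + Real.exp a) ^ 2 := by positivity
  rw [div_le_iff₀ hpos, Real.exp_neg, ← div_eq_inv_mul, le_div_iff₀ hea]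
  nlinarith [hea.le]

/-- `|J₀(ω) J₁(ω)| ≤ 1/2` (from `J₀² + J₁² ≤ 1`, DLMF 10.14.1, and `2|xy| ≤ x² + y²`).
[cite: LiebWuPhysicaA2003, §6] -/
theorem abs_besselJ_zero_mul_besselJ_one_le_half (ω : ℝ) :
    |besselJ 0 ω * besselJ 1 ω| ≤ 1 / 2 := by
  rw [abs_mul]
  have h2 := two_mul_le_add_sq (|besselJ 0 ω|) (|besselJ 1 ω|)
  rw [sq_abs, sq_abs] at h2
  have h1 := sq_besselJ_zero_add_sq_besselJ_one_le_one ω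
  nlinarith [abs_nonneg (besselJ 0 ω), abs_nonneg (besselJ 1 ω)]

/-- **Domination of the derivative integrand**: `|J₀ J₁ e^{ωU/2} / (2 (1 + e^{ωU/2})²)| ≤ e^{-(U/2) ω} / 4`
for all real `U`, `ω`. [cite: LiebWuPhysicaA2003, §6] -/
theorem abs_liebWuDoccIntegrand_le (U ω : ℝ) :
    |liebWuDoccIntegrand U ω| ≤ Real.exp (-(U / 2) * ω) / 4 := by
  have hJ := abs_besselJ_zero_mul_besselJ_one_le_half ω
  have hE := exp_div_one_add_exp_sq_le (ω * U / 2)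
  have hden : (0 : ℝ) < 2 * (1 + Real.exp (ω * U / 2)) ^ 2 := by positivity
  have hx : Real.exp (-(U / 2) * ω) = Real.exp (-(ω * U / 2)) := by ring_nf
  rw [liebWuDoccIntegrand, abs_div, abs_mul (besselJ 0 ω * besselJ 1 ω), abs_of_pos (Real.exp_pos _),
    abs_of_pos hden, hx]
  calc |besselJ 0 ω * besselJ 1 ω| * Real.exp (ω * U / 2) / (2 * (1 + Real.exp (ω * U / 2)) ^ 2)
      = |besselJ 0 ω * besselJ 1 ω| * (Real.exp (ω * U / 2) / (1 + Real.exp (ω * U / 2)) ^ 2) / 2 := by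
        field_simp
    _ ≤ (1 / 2) * Real.exp (-(ω * U / 2)) / 2 := by gcongr
    _ = Real.exp (-(ω * U / 2)) / 4 := by ring

/-- The derivative integrand is continuous (its denominator is positive). [cite: LiebWuPhysicaA2003, §6] -/
theorem continuous_liebWuDoccIntegrand (U : ℝ) : Continuous (liebWuDoccIntegrand U) := by
  have hnum : Continuous fun ω : ℝ => besselJ 0 ω * besselJ 1 ω * Real.exp (ω * U / 2) :=
    ((continuous_besselJ_holds 0).mul (continuous_besselJ_holds 1)).mul (by fun_prop)
  have hden : Continuous fun ω : ℝ => 2 * (1 + Real.exp (ω * U / 2)) ^ 2 := by fun_prop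
  exact hnum.div hden fun ω => by positivity

/-- **Differentiation under the integral sign.** For `U > 0` the derivative integrand is integrable
on `(0, ∞)` and `e(U) = liebWuEnergy U` has derivative `d(U) = liebWuDoubleOccupancy U`:
`e'(U) = 2 ∫₀^∞ J₀ J₁ e^{ωU/2} / (1 + e^{ωU/2})² dω` (dominated convergence with the bound
`e^{-ωU/4}/4` on the neighbourhood `U' > U/2`). [cite: LiebWuPRL1968, eq. (20)] -/
theorem integrableOn_liebWuDoccIntegrand_and_hasDerivAt_liebWuEnergy {U : ℝ} (hU : 0 < U) :
    IntegrableOn (liebWuDoccIntegrand U) (Ioi 0) ∧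
      HasDerivAt liebWuEnergy (liebWuDoubleOccupancy U) U := by
  have hs : Ioi (U / 2) ∈ 𝓝 U := Ioi_mem_nhds (by linarith)
  have hF_meas : ∀ᶠ x in 𝓝 U,
      AEStronglyMeasurable (liebWuEnergyIntegrand x) (volume.restrict (Ioi 0)) :=
    Eventually.of_forall fun x =>
      (continuousOn_liebWuEnergyIntegrand x).aestronglyMeasurable measurableSet_Ioi
  have hF_int : Integrable (liebWuEnergyIntegrand U) (volume.restrict (Ioi 0)) :=
    integrableOn_liebWuEnergy_integrand_holds hU
  have hF'_meas : AEStronglyMeasurable (fun ω => -liebWuDoccIntegrand U ω) (volume.restrict (Ioi 0)) :=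
    (continuous_liebWuDoccIntegrand U).neg.aestronglyMeasurable
  have h_bound : ∀ᵐ ω ∂(volume.restrict (Ioi (0 : ℝ))), ∀ x ∈ Ioi (U / 2),
      ‖-liebWuDoccIntegrand x ω‖ ≤ Real.exp (-(U / 4) * ω) / 4 := by
    refine ae_restrict_of_forall_mem measurableSet_Ioi fun ω hω x hx => ?_
    rw [norm_neg, Real.norm_eq_abs]
    refine (abs_liebWuDoccIntegrand_le x ω).trans ?_
    have hω' : (0 : ℝ) < ω := hω
    have hx' : U / 2 < x := hx
    have hexp : Real.exp (-(x / 2) * ω) ≤ Real.exp (-(U / 4) * ω) :=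
      Real.exp_le_exp.mpr (by nlinarith)
    linarith
  have bound_integrable : Integrable (fun ω => Real.exp (-(U / 4) * ω) / 4) (volume.restrict (Ioi 0)) :=
    (exp_neg_integrableOn_Ioi 0 (by positivity)).div_const 4
  have h_diff : ∀ᵐ ω ∂(volume.restrict (Ioi (0 : ℝ))), ∀ x ∈ Ioi (U / 2),
      HasDerivAt (fun x => liebWuEnergyIntegrand x ω) (-liebWuDoccIntegrand x ω) x :=
    ae_restrict_of_forall_mem measurableSet_Ioi fun ω hω x _ =>
      hasDerivAt_liebWuEnergyIntegrand (ne_of_gt hω) x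
  obtain ⟨hint, hderiv⟩ := hasDerivAt_integral_of_dominated_loc_of_deriv_le hs hF_meas hF_int
    hF'_meas h_bound bound_integrable h_diff
  refine ⟨?_, ?_⟩
  · have h' : Integrable (liebWuDoccIntegrand U) (volume.restrict (Ioi 0)) := by
      simpa using hint.neg
    exact h'
  have h4 := hderiv.const_mul (-4 : ℝ)
  have hfun : liebWuEnergy = fun x => -4 * ∫ ω in Ioi (0 : ℝ), liebWuEnergyIntegrand x ω := rfl
  rw [hfun]
  refine h4.congr_deriv ?_
  rw [liebWuDoubleOccupancy, integral_neg]
  ring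

/-- For `U > 0` the derivative integrand `J₀ J₁ e^{ωU/2} / (2 (1 + e^{ωU/2})²)` is integrable on
`(0, ∞)`. [cite: LiebWuPhysicaA2003, §6] -/
theorem integrableOn_liebWuDoccIntegrand {U : ℝ} (hU : 0 < U) :
    IntegrableOn (liebWuDoccIntegrand U) (Ioi 0) :=
  (integrableOn_liebWuDoccIntegrand_and_hasDerivAt_liebWuEnergy hU).1

/-- **`e'(U) = d(U)`**: the Lieb–Wu energy has derivative the Lieb–Wu double occupancy at every
`U > 0`. [cite: LiebWuPRL1968, eq. (20)] -/
theorem hasDerivAt_liebWuEnergy {U : ℝ} (hU : 0 < U) :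
    HasDerivAt liebWuEnergy (liebWuDoubleOccupancy U) U :=
  (integrableOn_liebWuDoccIntegrand_and_hasDerivAt_liebWuEnergy hU).2

/-- `deriv e U = d(U)` for `U > 0`. [cite: LiebWuPRL1968, eq. (20)] -/
theorem deriv_liebWuEnergy {U : ℝ} (hU : 0 < U) :
    deriv liebWuEnergy U = liebWuDoubleOccupancy U :=
  (hasDerivAt_liebWuEnergy hU).deriv

/-- `e` is differentiable at every `U > 0`. [cite: LiebWuPRL1968, eq. (20)] -/
theorem differentiableAt_liebWuEnergy {U : ℝ} (hU : 0 < U) :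
    DifferentiableAt ℝ liebWuEnergy U :=
  (hasDerivAt_liebWuEnergy hU).differentiableAt

end Hubbard

end Literature.Analysis.FunctionSpaces
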